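import Summits.QuantumFields.BalabanUV.Beta.D1BFx.GhostSqrtLeg
import Summits.QuantumFields.BalabanUV.Beta.D1BFx.KGhostLeg
import Summits.QuantumFields.BalabanUV.Beta.D1BFx.TorusGhostWordArrays

/-!
# `BalabanUV.Beta.D1BFx.GhostSqrtLegFib` — road «BF-x» for binder row D1, slot (K), chain step (S-GH), «GH-DICT» PART 2b, FILE 1∕2:
# THE PER-TORUS (S-GH) IDENTITY IN TA3b's FIBRED CURRENCY — leg `(Cgh n a)^`, bi-Laplacian words of `(lapU)^`, ANY site jets — AND THE
# TORUS PRODUCT LETTERS OF THE GHOST LEGS `Ggh`, `Pgt` AND THEIR COMPOSITES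

HONEST DEPENDENCY (page 1, mandatory): continuum YM on T⁴ ⇐ BetaPertH ∧ nine spine estimates (0/9 proved); BetaPertH ⇐ (D1) ∧ (D4) ∧
CAP+tail; G-an2-4 gates asym, D1 and NE2/3/4.  HONEST FRAMING (cell contract, verbatim): «discharging `BetaPertH` makes Bałaban's UV
stability UNCONDITIONAL — a real constructive-QFT result; it is NOT the continuum limit and NOT the Clay problem.»  THIS MODULE DISCHARGES
NOTHING of the wall: [folklore] re-indexing (`Site 4 s × Unit ↔ Site 4 s`) and finite-matrix algebra BY NAME over leaf-04 g16's `GhostSqrtLeg`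
(`hessT_sandwich_leg`, `eightWords_split`), the owner's `KGhostLeg` (`Cgh`, `periodiseF_toF_Cgh`, `periodiseF_toF_Rgt_eq_submatrix`,
`periodiseF_toF_comp`) and `PeriodisedProjector` (`AXhat_eq`, `Gshat_eq`, `Rhat_mul_Gshat`, `Shat_Ghat_Rhat` — the periodised tower equation and
the periodised B1), ne9-leaf-09's `TorusGhostLegs` (`periodiseF_AXgh_mul_Ggh`, `isPeriodic₂_Ggh`), the typer's `GhostLeg` (`decays_Ggh`,
`shiftK_Ggh`), leaf-05-g3's `RJetProjector` (`decays_Pgt`, `shiftK_Pgt`), leaf-03's `TorusGhostWordArrays` (`lapU`).  No definition, no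
`def … : Prop`, nothing cited, 0 sorry.  0 root-level binders discharged (hW ∕ hR-sockets ∕ hSX-socket ∕ D1Tel ∕ D1Rep = 0); NOT (K), NOT D1, NOT
`BetaPertH`, NOT continuum, NOT Clay.

ABSOLUTE RULE (cell charter, verbatim): «No internally-minted statement may enter as a cited fact. Every hypothesis is either kernel-proved in
this package or a verbatim quotation of a PUBLISHED theorem with page reference. The manuscript(s) under audit are NOT citable for their own
disputed steps — they are the thing under adjudication; programme-internal (2001/route/tribunal) claims are never citable.»

WHY (owner d1-p2, `DICT-CHAIN-SPEC.md` v1.2 §1 (S-GH) ∕ §7 «GH-DICT», rulings ρ-g14-2 and ρ-g15-1; first refusal leaf-04 lineage).  `GhostSqrtLeg` §4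
(p307400) states the per-torus (S-GH) identity for the leg `Chat s N = N̂(N̂ᵀL̂L̂N̂)⁻¹N̂ᵀ` of a basis `N` of `ker Ŝ`, in the UNFIBRED site currency
`Matrix (Site 4 s) (Site 4 s) ℝ`.  The `p → ∞` sockets that PART 2b uses (TA3b `TorusTraceTadpole`, TA3b-BUBBLE₂ `TorusTraceBubbleTwoLeg`,
`KGhostLeg.tendsto_hessT_Cgh`, `TorusGhostLegs.tendsto_hessT_Ggh`) and the consumer of the ghost slot ((A1) of record:
`KCombineCovTowers.tendsto_gramCov_tower`, `KCombineCovStripped.hessKer_transfer_road_cov_stripped` — `hessKer (Cgh (m+1) a) Lgh Lgh₂`) all speak the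
FIBRED currency `Matrix.of (periodiseF s (toF K))` on `Site 4 s × Unit`, with the leg `(Cgh n a)^ = n⁴•(Ggh)^(Rgt)^(Ggh)^` (`KGhostLeg.periodiseF_toF_Cgh`)
and NO basis `N`.  THIS FILE re-reads the identity in that currency (FILE 2 `GhostSqrtLegLimit` takes the limits):
* §1 [folklore] THE LETTERS: `(Pgt)^ = P̂`, `(lapU)^ = L̂` re-indexed along `Prod.fst` (`rfl`); `1 − (Pgt)^ = (Rgt)^`; `(Cgh)^ = (n²)²•Ĝ(1 − P̂)Ĝ`;
  **`torus_sockets_fib`**: the four hypotheses of `GhostSqrtLeg.hessT_sandwich_leg` at `G := (Ggh)^`, `c := n²`, `L := (lapU)^`,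
  `A := (AXgh)^ − n²•(lapU)^` (`= (a∕n⁴)•Ŝ` re-indexed), `R := 1 − (Pgt)^` — `Ĝ·(AXgh)^ = 1 = (AXgh)^·Ĝ` (periodised tower equation) and
  `(1 − P̂)·Ĝ·A = 0 = A·Ĝ·(1 − P̂)` (periodised B1).
* §2 [folklore] **`hessT_Cgh_biLaplacian_split`**: for ANY site matrices `V V′ W` on `Site 4 s × Unit` (`n ∣ s`),
  `hessT (Cgh)^ (V·L̂ + L̂·V) (V′·L̂ + L̂·V′) (W·L̂ + V·V′ + V′·V + L̂·W) = 2·hessT ((Ggh)^; n²•V, n²•V′, n²•W) − (sixteen explicit P̂-words)`,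
  `P̂ = (Pgt n a)^` — the ρ-g14-2 display (`GhostSqrtLeg.hessT_Chat_biLaplacian_split`) without `N`, in the sockets' currency.
* §3 [folklore] THE LEGS ON `ℤ⁴`: block-shift invariance ⇒ joint `(n·q)`-periodicity (`imageShift_mul_of_shiftK`), inherited by `comp`
  (`shiftK_comp_of_shiftK`); **`hat_legs`**: `(Pgt∘Ggh)^ = P̂Ĝ`, `(Ggh∘Pgt)^ = ĜP̂`, `(Ggh∘Ggh)^ = ĜĜ`, `(Ggh∘(Pgt∘Ggh))^ = ĜP̂Ĝ` on every `Site 4 (n·q)`.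
Unit `b2b-balaban-beta-d1-formalise-leaf-04` (gen 17), D1 formalisation swarm; journal INTENT [D1LEAF04-G17-INTENT-1].
-/

noncomputable section

namespace Summit.QuantumFields.BalabanUV.Beta.D1BFx.GhostSqrtLegFib

open Matrix
open scoped BigOperators
open Literature.MathematicalPhysics.QuantumFieldTheory.Balaban1983to89
open Literature.MathematicalPhysics.QuantumFieldTheory.Balaban1983to89.Beta
open ExpKernelCalculus (MKer Decays BiLoc comp shiftK comp_shiftK)
open Summit.QuantumFields.BalabanUV.Beta.TameKernelCalculus (decays_of_le)
open Summit.QuantumFields.BalabanUV.Beta.D1BFx.FibredPeriodisation (Kfib periodiseF periodiseF_apply)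
open Summit.QuantumFields.BalabanUV.Beta.D1BFx.PeriodicArrays (arr toF toF_apply Kfib_toF periodic_of_shiftK)
open Summit.QuantumFields.BalabanUV.Beta.D1BFx.MixedVarPackedHess (hessT)
open Summit.QuantumFields.BalabanUV.Beta.D1BFx.RProjector (Pgt Pgt_apply deltaPP deltaPP_pos)
open Summit.QuantumFields.BalabanUV.Beta.D1BFx.RJetProjector (Rgt decays_Pgt shiftK_Pgt)
open Summit.QuantumFields.BalabanUV.Beta.D1BFx.GhostLeg (Ggh decays_Ggh shiftK_Ggh pred_add_one cast_pred_add_one)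
open Summit.QuantumFields.BalabanUV.Beta.D1BFx.TorusGhostLegs (AXgh isPeriodic₂_Ggh periodiseF_Ggh_eq_submatrix periodiseF_AXgh_eq_submatrix
  periodiseF_AXgh_mul_Ggh)
open Summit.QuantumFields.BalabanUV.Beta.D1BFx.KGhostLeg (Cgh periodiseF_toF_Rgt_eq_submatrix periodiseF_toF_comp periodiseF_toF_Cgh)
open Summit.QuantumFields.BalabanUV.Beta.D1BFx.PeriodisedProjector (Lhat Shat Phat AXhat_eq Gshat_eq Rhat_mul_Gshat Shat_Ghat_Rhat)
open Summit.QuantumFields.BalabanUV.Beta.D1BFx.TorusGhostWordArrays (lapU)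
open Summit.QuantumFields.BalabanUV.Beta.D1BFx.GhostSqrtLeg (hessT_sandwich_leg eightWords_split)
open Literature.MathematicalPhysics.QuantumFieldTheory.Balaban1983to89.Beta.BalabanStepJetsSucc (decays_comp)
open B6QGQDecay237 (deltaU deltaU_pos)

/-! ## §1 The fibred torus letters: `(Pgt)^ = P̂`, `(lapU)^ = L̂`, `1 − (Pgt)^ = (Rgt)^`, `(Cgh)^ = (n²)²•Ĝ(1 − P̂)Ĝ`, the four sockets -/

section Letters

variable (n : ℕ) [NeZero n] (a : ℝ) {s : ℕ} [NeZero s]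

omit [NeZero n] in
/-- [folklore] **`(Pgt)^ = P̂` RE-INDEXED**: the fibred periodisation of the road's projector kernel `Pgt n a` IS the owner's torus matrix
`Phat (n − 1) a s` read along `Prod.fst` (both are `periodise₂ s (Pker (n−1) a)` entrywise; the twin of `TorusGhostLegs.periodiseF_Ggh_eq_submatrix`). -/
theorem periodiseF_toF_Pgt_eq_submatrix :
    Matrix.of (periodiseF s (toF (Pgt n a))) = (Phat (n - 1) a s).submatrix Prod.fst Prod.fst := by
  ext ⟨x, u⟩ ⟨y, v⟩
  rfl

/-- [folklore] **`(lapU)^ = L̂` RE-INDEXED** (`TorusGhostWordArrays.Lhat_eq_perT` read fibrewise). -/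
theorem periodiseF_toF_lapU_eq_submatrix :
    Matrix.of (periodiseF s (toF lapU)) = (Lhat s).submatrix Prod.fst Prod.fst := by
  ext ⟨x, u⟩ ⟨y, v⟩
  rfl

omit [NeZero n] in
/-- [folklore] **`1 − (Pgt)^ = (Rgt)^`** on every torus (`KGhostLeg.periodiseF_toF_Rgt_eq_submatrix` + `periodiseF_toF_Pgt_eq_submatrix`). -/
theorem one_sub_periodiseF_toF_Pgt (ha : 0 < a) :
    (1 : Matrix (Site 4 s × Unit) (Site 4 s × Unit) ℝ) - Matrix.of (periodiseF s (toF (Pgt n a)))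
      = Matrix.of (periodiseF s (toF (Rgt n a))) := by
  rw [periodiseF_toF_Rgt_eq_submatrix n a ha, periodiseF_toF_Pgt_eq_submatrix]
  ext ⟨x, u⟩ ⟨y, v⟩
  simp only [Matrix.sub_apply, Matrix.submatrix_apply, Matrix.one_apply, Prod.mk.injEq, and_true]

/-- [folklore] **`(Cgh)^ = (n²)²•Ĝ(1 − P̂)Ĝ`** in fibred currency (`KGhostLeg.periodiseF_toF_Cgh` with `(Rgt)^ = 1 − (Pgt)^`; `n⁴ = (n²)²`). -/
theorem periodiseF_toF_Cgh_eq (ha : 0 < a) (hdiv : n ∣ s) :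
    Matrix.of (periodiseF s (toF (Cgh n a)))
      = (((n : ℝ) ^ 2) ^ 2) • (Matrix.of (periodiseF s (toF (Ggh n a)))
          * ((1 : Matrix (Site 4 s × Unit) (Site 4 s × Unit) ℝ) - Matrix.of (periodiseF s (toF (Pgt n a))))
          * Matrix.of (periodiseF s (toF (Ggh n a)))) := by
  rw [periodiseF_toF_Cgh n a ha hdiv, one_sub_periodiseF_toF_Pgt n a ha, ← pow_mul]

/-- [folklore] **THE FOUR SOCKET HYPOTHESES OF `GhostSqrtLeg.hessT_sandwich_leg` IN FIBRED CURRENCY** on every fine torus `Site 4 s`, `n ∣ s`, at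
`G := (Ggh)^`, `c := n²`, `L := (lapU)^`, `A := (AXgh)^ − n²•(lapU)^` (`= (a∕n⁴)•Ŝ` re-indexed, `PeriodisedProjector.AXhat_eq`), `R := 1 − (Pgt)^`:
`Ĝ·(n²L̂ + A) = 1 = (n²L̂ + A)·Ĝ` (`TorusGhostLegs.periodiseF_AXgh_mul_Ggh` = the periodised tower equation) and `(1 − P̂)·Ĝ·A = 0 = A·Ĝ·(1 − P̂)`
(`PeriodisedProjector.Rhat_mul_Gshat`∕`Gshat_eq`∕`Shat_Ghat_Rhat` = periodised B1, read along `Prod.fst`). -/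
theorem torus_sockets_fib (ha : 0 < a) (hdiv : n ∣ s) :
    Matrix.of (periodiseF s (toF (Ggh n a)))
        * ((((n : ℝ) ^ 2) • Matrix.of (periodiseF s (toF lapU)))
          + (Matrix.of (periodiseF s (toF (AXgh n a))) - (((n : ℝ) ^ 2) • Matrix.of (periodiseF s (toF lapU))))) = 1
    ∧ ((((n : ℝ) ^ 2) • Matrix.of (periodiseF s (toF lapU)))
          + (Matrix.of (periodiseF s (toF (AXgh n a))) - (((n : ℝ) ^ 2) • Matrix.of (periodiseF s (toF lapU)))))
        * Matrix.of (periodiseF s (toF (Ggh n a))) = 1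
    ∧ ((1 : Matrix (Site 4 s × Unit) (Site 4 s × Unit) ℝ) - Matrix.of (periodiseF s (toF (Pgt n a))))
        * Matrix.of (periodiseF s (toF (Ggh n a)))
        * (Matrix.of (periodiseF s (toF (AXgh n a))) - (((n : ℝ) ^ 2) • Matrix.of (periodiseF s (toF lapU)))) = 0
    ∧ (Matrix.of (periodiseF s (toF (AXgh n a))) - (((n : ℝ) ^ 2) • Matrix.of (periodiseF s (toF lapU))))
        * Matrix.of (periodiseF s (toF (Ggh n a)))
        * ((1 : Matrix (Site 4 s × Unit) (Site 4 s × Unit) ℝ) - Matrix.of (periodiseF s (toF (Pgt n a)))) = 0 := by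
  obtain ⟨q, hq⟩ := hdiv
  have hs : s = (n - 1 + 1) * q := by rw [pred_add_one]; exact hq
  have hGA := periodiseF_AXgh_mul_Ggh n a ha (s := s) ⟨q, hq⟩
  refine ⟨by rw [add_sub_cancel]; exact hGA.2, by rw [add_sub_cancel]; exact hGA.1, ?_, ?_⟩
  · -- `A = ((a∕n⁴)•Ŝ)` re-indexed; `(1 − P̂)·Ĝ·Ŝ-word = 0` by `Rhat_mul_Gshat` ∘ `Gshat_eq`
    have hA : Matrix.of (periodiseF s (toF (AXgh n a))) - (((n : ℝ) ^ 2) • Matrix.of (periodiseF s (toF lapU)))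
        = ((a / ((((n - 1 : ℕ) : ℝ) + 1) ^ 4)) • Shat (n - 1) s).submatrix Prod.fst Prod.fst := by
      rw [periodiseF_AXgh_eq_submatrix, periodiseF_toF_lapU_eq_submatrix, AXhat_eq, cast_pred_add_one]
      ext ⟨x, u⟩ ⟨y, v⟩
      simp only [Matrix.sub_apply, Matrix.submatrix_apply, Matrix.add_apply, Matrix.smul_apply, smul_eq_mul, add_sub_cancel_left]
    have hbij : Function.Bijective (Prod.fst : Site 4 s × Unit → Site 4 s) := (Equiv.prodPUnit (Site 4 s)).bijective
    rw [hA, one_sub_periodiseF_toF_Pgt n a ha, periodiseF_toF_Rgt_eq_submatrix n a ha, periodiseF_Ggh_eq_submatrix,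
      ← Matrix.submatrix_mul _ _ Prod.fst Prod.fst Prod.fst hbij, ← Matrix.submatrix_mul _ _ Prod.fst Prod.fst Prod.fst hbij,
      Matrix.mul_smul, Matrix.mul_assoc, ← Gshat_eq ha hs, Rhat_mul_Gshat ha hs, smul_zero, Matrix.submatrix_zero]
    rfl
  · have hA : Matrix.of (periodiseF s (toF (AXgh n a))) - (((n : ℝ) ^ 2) • Matrix.of (periodiseF s (toF lapU)))
        = ((a / ((((n - 1 : ℕ) : ℝ) + 1) ^ 4)) • Shat (n - 1) s).submatrix Prod.fst Prod.fst := by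
      rw [periodiseF_AXgh_eq_submatrix, periodiseF_toF_lapU_eq_submatrix, AXhat_eq, cast_pred_add_one]
      ext ⟨x, u⟩ ⟨y, v⟩
      simp only [Matrix.sub_apply, Matrix.submatrix_apply, Matrix.add_apply, Matrix.smul_apply, smul_eq_mul, add_sub_cancel_left]
    have hbij : Function.Bijective (Prod.fst : Site 4 s × Unit → Site 4 s) := (Equiv.prodPUnit (Site 4 s)).bijective
    rw [hA, one_sub_periodiseF_toF_Pgt n a ha, periodiseF_toF_Rgt_eq_submatrix n a ha, periodiseF_Ggh_eq_submatrix,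
      ← Matrix.submatrix_mul _ _ Prod.fst Prod.fst Prod.fst hbij, ← Matrix.submatrix_mul _ _ Prod.fst Prod.fst Prod.fst hbij,
      Matrix.smul_mul, Matrix.smul_mul, Shat_Ghat_Rhat ha hs, smul_zero, Matrix.submatrix_zero]
    rfl

end Letters

/-! ## §2 The per-torus (S-GH) identity in fibred currency: leg `(Cgh)^`, bi-Laplacian words of `(lapU)^`, ANY site jets -/

section Torus

variable (n : ℕ) [NeZero n] (a : ℝ) {s : ℕ} [NeZero s]

/-- [folklore] **(S-GH) ON THE FINE TORUS `Site 4 s` (`n ∣ s`), TA3b's FIBRED CURRENCY, ρ-g14-2 DISPLAY.**  For ANY site matrices `V V′ W` on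
`Site 4 s × Unit`: the Hessian functional of the periodised composite ghost leg `(Cgh n a)^` over the bi-Laplacian words of `L̂ = (lapU)^`,
`hessT (Cgh)^ (V·L̂ + L̂·V) (V′·L̂ + L̂·V′) (W·L̂ + V·V′ + V′·V + L̂·W)`, EQUALS `2·hessT ((Ggh)^; n²•V, n²•V′, n²•W)` MINUS the sixteen explicit
`P̂`-words at `Ĝ := (Ggh n a)^`, `P̂ := (Pgt n a)^` (`GhostSqrtLeg.hessT_sandwich_leg` on the sockets `torus_sockets_fib`, then `eightWords_split`).
The same identity as `GhostSqrtLeg.hessT_Chat_biLaplacian_split`, WITHOUT a basis `N` of `ker Ŝ` and in the currency of the `p → ∞` sockets. -/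
theorem hessT_Cgh_biLaplacian_split (ha : 0 < a) (hdiv : n ∣ s) (V V' W : Matrix (Site 4 s × Unit) (Site 4 s × Unit) ℝ) :
    hessT (Matrix.of (periodiseF s (toF (Cgh n a))))
        (V * Matrix.of (periodiseF s (toF lapU)) + Matrix.of (periodiseF s (toF lapU)) * V) (V' * Matrix.of (periodiseF s (toF lapU)) + Matrix.of (periodiseF s (toF lapU)) * V')
        (W * Matrix.of (periodiseF s (toF lapU)) + V * V' + V' * V + Matrix.of (periodiseF s (toF lapU)) * W)
      = 2 * hessT (Matrix.of (periodiseF s (toF (Ggh n a)))) (((n : ℝ) ^ 2) • V) (((n : ℝ) ^ 2) • V') (((n : ℝ) ^ 2) • W)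
        - ((1 / 2) * ((Matrix.of (periodiseF s (toF (Pgt n a))) * Matrix.of (periodiseF s (toF (Ggh n a))) * (((n : ℝ) ^ 2) • W)).trace
            + (Matrix.of (periodiseF s (toF (Ggh n a))) * Matrix.of (periodiseF s (toF (Pgt n a))) * (((n : ℝ) ^ 2) • W)).trace
            + (Matrix.of (periodiseF s (toF (Ggh n a))) * Matrix.of (periodiseF s (toF (Pgt n a))) * Matrix.of (periodiseF s (toF (Ggh n a))) * ((((n : ℝ) ^ 2) • V) * (((n : ℝ) ^ 2) • V'))).trace
            + (Matrix.of (periodiseF s (toF (Ggh n a))) * Matrix.of (periodiseF s (toF (Pgt n a))) * Matrix.of (periodiseF s (toF (Ggh n a))) * ((((n : ℝ) ^ 2) • V') * (((n : ℝ) ^ 2) • V))).trace)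
          - (1 / 2) * ((Matrix.of (periodiseF s (toF (Ggh n a))) * (((n : ℝ) ^ 2) • V) * (Matrix.of (periodiseF s (toF (Pgt n a))) * Matrix.of (periodiseF s (toF (Ggh n a))) * (((n : ℝ) ^ 2) • V'))).trace
            + (Matrix.of (periodiseF s (toF (Pgt n a))) * Matrix.of (periodiseF s (toF (Ggh n a))) * (((n : ℝ) ^ 2) • V) * (Matrix.of (periodiseF s (toF (Ggh n a))) * (((n : ℝ) ^ 2) • V'))).trace
            + (Matrix.of (periodiseF s (toF (Ggh n a))) * Matrix.of (periodiseF s (toF (Ggh n a))) * (((n : ℝ) ^ 2) • V) * (Matrix.of (periodiseF s (toF (Pgt n a))) * (((n : ℝ) ^ 2) • V'))).trace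
            + (Matrix.of (periodiseF s (toF (Ggh n a))) * Matrix.of (periodiseF s (toF (Pgt n a))) * Matrix.of (periodiseF s (toF (Ggh n a))) * (((n : ℝ) ^ 2) • V) * (((n : ℝ) ^ 2) • V')).trace
            + ((((n : ℝ) ^ 2) • V) * (Matrix.of (periodiseF s (toF (Ggh n a))) * Matrix.of (periodiseF s (toF (Pgt n a))) * Matrix.of (periodiseF s (toF (Ggh n a))) * (((n : ℝ) ^ 2) • V'))).trace
            + (Matrix.of (periodiseF s (toF (Pgt n a))) * (((n : ℝ) ^ 2) • V) * (Matrix.of (periodiseF s (toF (Ggh n a))) * Matrix.of (periodiseF s (toF (Ggh n a))) * (((n : ℝ) ^ 2) • V'))).trace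
            + (Matrix.of (periodiseF s (toF (Ggh n a))) * (((n : ℝ) ^ 2) • V) * (Matrix.of (periodiseF s (toF (Ggh n a))) * Matrix.of (periodiseF s (toF (Pgt n a))) * (((n : ℝ) ^ 2) • V'))).trace
            + (Matrix.of (periodiseF s (toF (Ggh n a))) * Matrix.of (periodiseF s (toF (Pgt n a))) * (((n : ℝ) ^ 2) • V) * (Matrix.of (periodiseF s (toF (Ggh n a))) * (((n : ℝ) ^ 2) • V'))).trace)
          + (1 / 2) * ((Matrix.of (periodiseF s (toF (Pgt n a))) * Matrix.of (periodiseF s (toF (Ggh n a))) * (((n : ℝ) ^ 2) • V) * (Matrix.of (periodiseF s (toF (Pgt n a))) * Matrix.of (periodiseF s (toF (Ggh n a))) * (((n : ℝ) ^ 2) • V'))).trace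
            + (Matrix.of (periodiseF s (toF (Ggh n a))) * Matrix.of (periodiseF s (toF (Pgt n a))) * Matrix.of (periodiseF s (toF (Ggh n a))) * (((n : ℝ) ^ 2) • V) * (Matrix.of (periodiseF s (toF (Pgt n a))) * (((n : ℝ) ^ 2) • V'))).trace
            + (Matrix.of (periodiseF s (toF (Pgt n a))) * (((n : ℝ) ^ 2) • V) * (Matrix.of (periodiseF s (toF (Ggh n a))) * Matrix.of (periodiseF s (toF (Pgt n a))) * Matrix.of (periodiseF s (toF (Ggh n a))) * (((n : ℝ) ^ 2) • V'))).trace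
            + (Matrix.of (periodiseF s (toF (Ggh n a))) * Matrix.of (periodiseF s (toF (Pgt n a))) * (((n : ℝ) ^ 2) • V) * (Matrix.of (periodiseF s (toF (Ggh n a))) * Matrix.of (periodiseF s (toF (Pgt n a))) * (((n : ℝ) ^ 2) • V'))).trace)) := by
  obtain ⟨hGK, hKG, hRGA, hAGR⟩ := torus_sockets_fib n a ha hdiv
  rw [periodiseF_toF_Cgh_eq n a ha hdiv,
    hessT_sandwich_leg (Matrix.of (periodiseF s (toF (Ggh n a))))
      ((1 : Matrix (Site 4 s × Unit) (Site 4 s × Unit) ℝ) - Matrix.of (periodiseF s (toF (Pgt n a)))) (Matrix.of (periodiseF s (toF lapU)))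
      (Matrix.of (periodiseF s (toF (AXgh n a))) - (((n : ℝ) ^ 2) • Matrix.of (periodiseF s (toF lapU)))) V V' W ((n : ℝ) ^ 2) hGK hKG hRGA hAGR]
  exact eightWords_split (Matrix.of (periodiseF s (toF (Ggh n a)))) (Matrix.of (periodiseF s (toF (Pgt n a)))) (((n : ℝ) ^ 2) • V) (((n : ℝ) ^ 2) • V') (((n : ℝ) ^ 2) • W)

end Torus

/-! ## §3 The legs on `ℤ⁴`: joint periodicity along `n·p`, decay of the composites, the torus product letters -/

section Legs

variable (n : ℕ) [NeZero n] (a : ℝ)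

omit [NeZero n] in
/-- [folklore] A kernel invariant under the block shifts `n•t` is jointly `(n·q)`-periodic (`PeriodicArrays.periodic_of_shiftK`). -/
theorem imageShift_mul_of_shiftK {A : MKer 4 Unit} (hA : ∀ t : Fin 4 → ℤ, shiftK ((n : ℤ) • t) A = A) (q : ℕ) (x y t : Fin 4 → ℤ)
    (u v : Unit) : A (imageShift (n * q) x t) (imageShift (n * q) y t) u v = A x y u v := by
  refine periodic_of_shiftK (fun t' => ?_) x y t u v
  have e : ((n * q : ℕ) : ℤ) • t' = (n : ℤ) • ((q : ℤ) • t') := by rw [Nat.cast_mul, mul_smul]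
  rw [e, hA]

omit [NeZero n] in
/-- [folklore] Block-shift invariance is inherited by compositions (`ExpKernelCalculus.comp_shiftK`). -/
theorem shiftK_comp_of_shiftK {A B : MKer 4 Unit} (hA : ∀ t : Fin 4 → ℤ, shiftK ((n : ℤ) • t) A = A)
    (hB : ∀ t : Fin 4 → ℤ, shiftK ((n : ℤ) • t) B = B) (t : Fin 4 → ℤ) : shiftK ((n : ℤ) • t) (comp A B) = comp A B := by
  rw [← comp_shiftK, hA, hB]

/-- [folklore] **THE TORUS PRODUCT LETTERS OF THE GHOST LEGS** on every fine torus `Site 4 (n·q)`: `(Pgt∘Ggh)^ = P̂·Ĝ`, `(Ggh∘Pgt)^ = Ĝ·P̂`,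
`(Ggh∘Ggh)^ = Ĝ·Ĝ`, `(Ggh∘(Pgt∘Ggh))^ = Ĝ·P̂·Ĝ` (`KGhostLeg.periodiseF_toF_comp` on `decays_Ggh`∕`decays_Pgt` + block-shift invariance). -/
theorem hat_legs (ha : 0 < a) (q : ℕ) [NeZero q] :
    Matrix.of (periodiseF (n * q) (toF (comp (Pgt n a) (Ggh n a))))
        = Matrix.of (periodiseF (n * q) (toF (Pgt n a))) * Matrix.of (periodiseF (n * q) (toF (Ggh n a)))
    ∧ Matrix.of (periodiseF (n * q) (toF (comp (Ggh n a) (Pgt n a))))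
        = Matrix.of (periodiseF (n * q) (toF (Ggh n a))) * Matrix.of (periodiseF (n * q) (toF (Pgt n a)))
    ∧ Matrix.of (periodiseF (n * q) (toF (comp (Ggh n a) (Ggh n a))))
        = Matrix.of (periodiseF (n * q) (toF (Ggh n a))) * Matrix.of (periodiseF (n * q) (toF (Ggh n a)))
    ∧ Matrix.of (periodiseF (n * q) (toF (comp (Ggh n a) (comp (Pgt n a) (Ggh n a)))))
        = Matrix.of (periodiseF (n * q) (toF (Ggh n a))) * Matrix.of (periodiseF (n * q) (toF (Pgt n a)))
          * Matrix.of (periodiseF (n * q) (toF (Ggh n a))) := by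
  have h4 : 0 < 4 * (n : ℝ) := mul_pos four_pos (Nat.cast_pos.2 (Nat.pos_of_ne_zero (NeZero.ne n)))
  have hδG : 0 < deltaU 4 a / (4 * n) := div_pos (deltaU_pos 4 ha) h4
  have hδP : 0 < deltaPP 4 a / (4 * n) := div_pos (deltaPP_pos 4 ha) h4
  have hG := decays_Ggh n a ha
  have hP := decays_Pgt n a ha
  have perG : ∀ u v : Unit, IsPeriodic₂ (n * q) (Kfib (toF (Ggh n a)) u v) := isPeriodic₂_Ggh n a ha ⟨q, rfl⟩
  have perP : ∀ u v : Unit, IsPeriodic₂ (n * q) (Kfib (toF (Pgt n a)) u v) := fun u v x y t =>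
    imageShift_mul_of_shiftK n (shiftK_Pgt n ha) q x y t u v
  have hPG := periodiseF_toF_comp hP hδP hG hδG perG
  refine ⟨hPG, periodiseF_toF_comp hG hδG hP hδP perP, periodiseF_toF_comp hG hδG hG hδG perG, ?_⟩
  -- the sandwich: `Pgt∘Ggh` decays at half the common rate and is block-shift invariant
  have hm : 0 < min (deltaU 4 a / (4 * n)) (deltaPP 4 a / (4 * n)) := lt_min hδG hδP
  have hPGdec := decays_comp (decays_of_le hP (min_le_right _ _ : min (deltaU 4 a / (4 * n)) (deltaPP 4 a / (4 * n)) ≤ _))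
    (decays_of_le hG (min_le_left _ _ : min (deltaU 4 a / (4 * n)) (deltaPP 4 a / (4 * n)) ≤ _)) (half_pos hm).le (half_lt_self hm)
  have perPG : ∀ u v : Unit, IsPeriodic₂ (n * q) (Kfib (toF (comp (Pgt n a) (Ggh n a))) u v) := fun u v x y t =>
    imageShift_mul_of_shiftK n (shiftK_comp_of_shiftK n (shiftK_Pgt n ha) (shiftK_Ggh n a ha)) q x y t u v
  rw [periodiseF_toF_comp hG hδG hPGdec (half_pos hm) perPG, hPG, Matrix.mul_assoc]

end Legs

end Summit.QuantumFields.BalabanUV.Beta.D1BFx.GhostSqrtLegFib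

end
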